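import Literature.AnabelianGeometry.Anabelioids.Induction
import HarnessLib

/-!
# Induction for `B(G)`, II: the induced `G`-set `G ×_U T` and the equivalence `B(G)_{G/U} ≌ B(U)`

Sequel to `Anabelioids/Induction.lean` (fibre functor `Over (G ⧸ₐ U) ⥤ B(U)`, full and faithful).
Here, for a finite continuous `U`-set `T` (`U ⊆ G` open of finite index), the **induced `G`-set**
`G ×_U T := (G × T)/[(g, t) ∼ (g u⁻¹, u t)]` with `x • [g, t] = [xg, t]` and structure map
`[g, t] ↦ gU` is an object `Induction.indOver T` of `B(G)_{G/U}` whose fibre over `eU` is `T`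
(`Induction.fiberIndIso`), so the fibre functor is essentially surjective and hence an equivalence
`Induction.fiberEquivalence U hU : Over (quotObj U hU) ≌ BCat U` — the dictionary behind [GeoAn]
Remark 1.2.2.1 (S. Mochizuki, *The geometry of anabelioids*, Publ. RIMS 40 (2004), p. 17)
[cite: MochizukiGeoAn2004, Rem. 1.2.2.1 p.17]; classically SGA1 V §6.
-/

noncomputable section

namespace Literature.AnabelianGeometry.Anabelioids

open CategoryTheory CategoryTheory.Limits
open Literature.AlgebraicGeometry.Frobenioids (BCat)
open scoped FintypeCatDiscrete Pointwise Topology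

universe u

namespace Induction

section Algebra

variable {G : Type u} [Group G] [TopologicalSpace G] {U : Subgroup G}

/-! ### The induced `G`-set `G ×_U T` -/

variable (U) in
/-- The relation `(g, t) ∼ (g u⁻¹, u • t)` (`u ∈ U`) on `G × T`. [cite: MochizukiGeoAn2004, Rem. 1.2.2.1 p.17] -/
def indSetoid (T : BCat U) : Setoid (G × T.obj.V) where
  r p q := ∃ u : U, q.1 = p.1 * (u : G)⁻¹ ∧ q.2 = u • p.2
  iseqv :=
    { refl := fun p => ⟨1, by simp⟩
      symm := fun {p q} ⟨u, h1, h2⟩ => ⟨u⁻¹, by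
        rw [h1, h2, Subgroup.coe_inv, inv_inv, inv_mul_cancel_right, inv_smul_smul]
        exact ⟨rfl, rfl⟩⟩
      trans := fun {p q r} ⟨u, h1, h2⟩ ⟨v, h3, h4⟩ => ⟨v * u, by
        rw [h3, h4, h1, h2, Subgroup.coe_mul, mul_inv_rev, mul_assoc, mul_smul]
        exact ⟨rfl, rfl⟩⟩ }

variable (U) in
/-- **The induced `G`-set** `G ×_U T` (as a type). [cite: MochizukiGeoAn2004, Rem. 1.2.2.1 p.17] -/
def IndCarrier (T : BCat U) : Type u := Quotient (indSetoid U T)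

/-- The class `[g, t] ∈ G ×_U T`. [cite: MochizukiGeoAn2004, Rem. 1.2.2.1 p.17] -/
def indMk (T : BCat U) (g : G) (t : T.obj.V) : IndCarrier U T := Quotient.mk (indSetoid U T) (g, t)

/-- `[g u, t] = [g, u • t]`. [cite: MochizukiGeoAn2004, Rem. 1.2.2.1 p.17] -/
theorem indMk_mul_coe (T : BCat U) (g : G) (u : U) (t : T.obj.V) :
    indMk T (g * (u : G)) t = indMk T g (u • t) :=
  Quotient.sound ⟨u, by rw [mul_inv_cancel_right]; exact ⟨rfl, rfl⟩⟩

/-- `[g, t] = [g', t']` iff `g' = g u⁻¹`, `t' = u • t` for some `u ∈ U`.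
[cite: MochizukiGeoAn2004, Rem. 1.2.2.1 p.17] -/
theorem indMk_eq_indMk_iff (T : BCat U) (g g' : G) (t t' : T.obj.V) :
    indMk T g t = indMk T g' t' ↔ ∃ u : U, g' = g * (u : G)⁻¹ ∧ t' = u • t :=
  Quotient.eq (r := indSetoid U T)

/-- Every element of `G ×_U T` is a class `[g, t]`. [cite: MochizukiGeoAn2004, Rem. 1.2.2.1 p.17] -/
theorem indMk_surjective (T : BCat U) : ∀ c : IndCarrier U T, ∃ g t, indMk T g t = c := by
  intro c
  induction c using Quotient.inductionOn with
  | h p => exact ⟨p.1, p.2, rfl⟩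

/-- The `G`-action on `G ×_U T`: `x • [g, t] = [x g, t]`. [cite: MochizukiGeoAn2004, Rem. 1.2.2.1 p.17] -/
instance (T : BCat U) : MulAction G (IndCarrier U T) where
  smul x := Quotient.map (fun p : G × T.obj.V => (x * p.1, p.2)) fun p q ⟨u, h1, h2⟩ =>
    ⟨u, by rw [h1, h2, mul_assoc]; exact ⟨rfl, rfl⟩⟩
  one_smul c := by
    induction c using Quotient.inductionOn with
    | h p =>
      change indMk T (1 * p.1) p.2 = indMk T p.1 p.2
      rw [one_mul]
  mul_smul x y c := by
    induction c using Quotient.inductionOn with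
    | h p =>
      change indMk T (x * y * p.1) p.2 = indMk T (x * (y * p.1)) p.2
      rw [mul_assoc]

/-- `x • [g, t] = [x g, t]`. [cite: MochizukiGeoAn2004, Rem. 1.2.2.1 p.17] -/
@[simp] theorem smul_indMk (T : BCat U) (x g : G) (t : T.obj.V) :
    x • indMk T g t = indMk T (x * g) t := rfl

/-- The structure map `G ×_U T → G/U`, `[g, t] ↦ gU`, as a function.
[cite: MochizukiGeoAn2004, Rem. 1.2.2.1 p.17] -/
def indProjFun (T : BCat U) : IndCarrier U T → G ⧸ U :=
  Quotient.lift (fun p : G × T.obj.V => (p.1 : G ⧸ U)) fun p q ⟨u, h1, _⟩ => by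
    rw [h1, QuotientGroup.eq, inv_mul_cancel_left]
    exact U.inv_mem u.2

/-- `[g, t] ↦ gU`. [cite: MochizukiGeoAn2004, Rem. 1.2.2.1 p.17] -/
@[simp] theorem indProjFun_indMk (T : BCat U) (g : G) (t : T.obj.V) :
    indProjFun T (indMk T g t) = (g : G ⧸ U) := rfl

variable [Finite (G ⧸ U)]

/-- `G ×_U T` is finite (image of `G/U × T` by `(gU, t) ↦ [g₀, t]`, `g₀` a representative).
[cite: MochizukiGeoAn2004, Rem. 1.2.2.1 p.17] -/
instance (T : BCat U) : Finite (IndCarrier U T) := by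
  refine Finite.of_surjective (fun p : (G ⧸ U) × T.obj.V => indMk T (Quotient.out p.1) p.2) ?_
  intro c
  obtain ⟨g, t, rfl⟩ := indMk_surjective T c
  have hu : (Quotient.out (g : G ⧸ U))⁻¹ * g ∈ U := by
    rw [← QuotientGroup.eq]
    exact QuotientGroup.out_eq' _
  refine ⟨((g : G ⧸ U), (⟨_, hu⟩ : U) • t), ?_⟩
  change indMk T (Quotient.out (g : G ⧸ U)) ((⟨_, hu⟩ : U) • t) = indMk T g t
  rw [← indMk_mul_coe]
  congr 1
  rw [mul_inv_cancel_left]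

/-- The induced `G`-set as a finite `G`-set. [cite: MochizukiGeoAn2004, Rem. 1.2.2.1 p.17] -/
def indAction (T : BCat U) : Action FintypeCat.{u} G :=
  Action.FintypeCat.ofMulAction G (FintypeCat.of (IndCarrier U T))

end Algebra

section Topology

variable {G : Type u} [Group G] [TopologicalSpace G] [IsTopologicalGroup G]
variable {U : Subgroup G} {hU : IsOpen (U : Set G)} [Finite (G ⧸ U)]

/-- Continuity of the induced action: the stabiliser of `[g, t]` contains the open set
`g · Stab_U(t) · g⁻¹`. [cite: MochizukiGeoAn2004, Rem. 1.2.2.1 p.17] -/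
theorem isContinuous_indAction (hU : IsOpen (U : Set G)) (T : BCat U) :
    Action.IsContinuous (indAction T) := by
  rw [isContinuous_iff]
  intro c
  obtain ⟨g, t, rfl⟩ := indMk_surjective T c
  -- the open set `{x | g⁻¹ x g ∈ Stab_U(t)}` is contained in the stabiliser and contains `1`
  have hT : IsOpen (MulAction.stabilizer U t : Set U) := (isContinuous_iff T.obj).mp T.property t
  have hK : IsOpen (((↑) : U → G) '' (MulAction.stabilizer U t : Set U)) :=
    hU.isOpenMap_subtype_val _ hT
  set K : Set G := (fun x : G => g⁻¹ * x * g) ⁻¹' (((↑) : U → G) '' (MulAction.stabilizer U t : Set U))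
    with hKdef
  have hKopen : IsOpen K := hK.preimage (by fun_prop)
  have h1 : (1 : G) ∈ K := by
    refine ⟨1, ?_, by simp⟩
    simp only [SetLike.mem_coe, MulAction.mem_stabilizer_iff, one_smul]
  have hsub : K ⊆ (MulAction.stabilizer G (indMk T g t : (indAction T).V) : Set G) := by
    rintro x ⟨u, hu, hx⟩
    rw [SetLike.mem_coe, MulAction.mem_stabilizer_iff] at hu ⊢
    have hx' : x = g * (u : G) * g⁻¹ := by
      rw [hx]; group
    change x • indMk T g t = indMk T g t
    rw [smul_indMk, hx', inv_mul_cancel_right, indMk_mul_coe, hu]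
  apply Subgroup.isOpen_of_mem_nhds _ (g := 1)
  exact Filter.mem_of_superset (hKopen.mem_nhds h1) hsub

/-- The induced `G`-set as an object of `B(G)`. [cite: MochizukiGeoAn2004, Rem. 1.2.2.1 p.17] -/
def indObj (hU : IsOpen (U : Set G)) (T : BCat U) : BCat G :=
  ⟨indAction T, isContinuous_indAction hU T⟩

/-- The structure map `G ×_U T → G/U` in `B(G)`. [cite: MochizukiGeoAn2004, Rem. 1.2.2.1 p.17] -/
def indProj (hU : IsOpen (U : Set G)) (T : BCat U) : indObj hU T ⟶ quotObj U hU :=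
  ObjectProperty.homMk
    { hom := FintypeCat.homMk (indProjFun T)
      comm := fun x => by
        apply FintypeCat.hom_ext
        intro c
        obtain ⟨g, t, rfl⟩ := indMk_surjective T c
        simp only [FintypeCat.comp_apply, FintypeCat.homMk_apply]
        change indProjFun T (x • indMk T g t) = x • ((g : G ⧸ U) : (G ⧸ₐ U).V)
        rw [smul_indMk, indProjFun_indMk, quotObj_smul_mk] }

/-- **The induced object** `(G ×_U T → G/U)` of `B(G)_{G/U}`. [cite: MochizukiGeoAn2004, Rem. 1.2.2.1 p.17] -/
def indOver (hU : IsOpen (U : Set G)) (T : BCat U) : Over (quotObj U hU) :=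
  Over.mk (indProj hU T)

/-- Unfolding lemma (`indOver_hom_apply`). [cite: MochizukiGeoAn2004, Rem. 1.2.2.1 p.17] -/
@[simp] theorem indOver_hom_apply (T : BCat U) (g : G) (t : T.obj.V) :
    (indOver hU T).hom.hom.hom (indMk T g t : (indObj hU T).obj.V) = ((g : G ⧸ U) : (G ⧸ₐ U).V) :=
  rfl

/-! ### The fibre of the induced object is `T` -/

/-- `t ↦ [1, t]` lands in the fibre over `eU`. [cite: MochizukiGeoAn2004, Rem. 1.2.2.1 p.17] -/
def toFiberInd (T : BCat U) (t : T.obj.V) : Fiber (indOver hU T) :=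
  ⟨(indMk T 1 t : (indObj hU T).obj.V), rfl⟩

/-- Unfolding lemma (`toFiberInd_val`). [cite: MochizukiGeoAn2004, Rem. 1.2.2.1 p.17] -/
@[simp] theorem toFiberInd_val (T : BCat U) (t : T.obj.V) :
    (toFiberInd (hU := hU) T t).1 = (indMk T 1 t : (indObj hU T).obj.V) := rfl

/-- `t ↦ [1, t]` is `U`-equivariant: `[1, u • t] = [u, t] = u • [1, t]`.
[cite: MochizukiGeoAn2004, Rem. 1.2.2.1 p.17] -/
theorem toFiberInd_smul (T : BCat U) (u : U) (t : T.obj.V) :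
    toFiberInd (hU := hU) T (u • t) = u • toFiberInd T t := by
  apply Subtype.ext
  rw [Fiber.smul_val, toFiberInd_val, toFiberInd_val]
  change indMk T 1 (u • t) = (u : G) • indMk T 1 t
  rw [smul_indMk, mul_one, ← indMk_mul_coe, one_mul]

/-- `t ↦ [1, t]` is a bijection onto the fibre over `eU`. [cite: MochizukiGeoAn2004, Rem. 1.2.2.1 p.17] -/
theorem toFiberInd_bijective (T : BCat U) : Function.Bijective (toFiberInd (hU := hU) T) := by
  constructor
  · intro t t' h
    have h' := congrArg Subtype.val h
    rw [toFiberInd_val, toFiberInd_val] at h'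
    obtain ⟨u, h1, h2⟩ := (indMk_eq_indMk_iff T 1 1 t t').mp h'
    have hu1 : (u : G) = 1 := by
      rw [one_mul] at h1
      exact inv_eq_one.mp h1.symm
    have hu : u = 1 := Subtype.ext hu1
    rw [h2, hu, one_smul]
  · rintro ⟨c, hc⟩
    obtain ⟨g, t, rfl⟩ := indMk_surjective T c
    have hg : g ∈ U := by
      have hc' : ((g : G ⧸ U) : (G ⧸ₐ U).V) = basePt U hU := hc
      change (g : G ⧸ U) = ((1 : G) : G ⧸ U) at hc'
      rw [QuotientGroup.eq, mul_one, inv_mem_iff] at hc'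
      exact hc'
    refine ⟨(⟨g, hg⟩ : U) • t, Subtype.ext ?_⟩
    rw [toFiberInd_val]
    change indMk T 1 ((⟨g, hg⟩ : U) • t) = indMk T g t
    rw [← indMk_mul_coe, one_mul]

/-- **The fibre of `G ×_U T` over `eU` is `T`**, as an isomorphism in `B(U)`.
[cite: MochizukiGeoAn2004, Rem. 1.2.2.1 p.17] -/
def fiberIndIso (T : BCat U) : (fiber U hU).obj (indOver hU T) ≅ T :=
  (ObjectProperty.isoMk _
    (Action.mkIso (FintypeCat.equivEquivIso (Equiv.ofBijective _ (toFiberInd_bijective (hU := hU) T)))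
      fun u => by
        apply FintypeCat.hom_ext
        intro t
        simp only [FintypeCat.comp_apply]
        change toFiberInd T (u • t) = u • toFiberInd T t
        exact toFiberInd_smul T u t)).symm


/-! ### The equivalence -/

variable (U hU) in
/-- The fibre functor is **essentially surjective**: `T ≅ (G ×_U T)_{eU}`.
[cite: MochizukiGeoAn2004, Rem. 1.2.2.1 p.17] -/
instance essSurj_fiber : (fiber U hU).EssSurj where
  mem_essImage T := ⟨indOver hU T, ⟨fiberIndIso T⟩⟩

variable (U hU) in
/-- The fibre functor `B(G)_{G/U} ⥤ B(U)` is an equivalence of categories.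
[cite: MochizukiGeoAn2004, Rem. 1.2.2.1 p.17] -/
instance isEquivalence_fiber : (fiber U hU).IsEquivalence where

variable (U hU) in
/-- **`B(G)_{G/U} ≌ B(U)`** (fibre over the base coset; quasi-inverse: induction `T ↦ G ×_U T`).
[cite: MochizukiGeoAn2004, Rem. 1.2.2.1 p.17] -/
def fiberEquivalence : Over (quotObj U hU) ≌ BCat U :=
  (fiber U hU).asEquivalence

end Topology

end Induction

end Literature.AnabelianGeometry.Anabelioids

end
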